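import Literature.Analysis.SpecialFunctions.GegenbauerOrthogonality
import Mathlib.Topology.ContinuousMap.Weierstrass
import HarnessLib

/-!
# Route `ColdStartUniversality`, crux K_A1 `UniformColdStartMixing` (stmt-QuantumFields-24809), rung `stub_fixedCutoffMixing`:
# Weierstrass approximation on `[-1, 1]` in the Chebyshev basis `U_n = C_n^{(1)}`

Helper file (seat `ym-line-csu-p1`, g7).  The laws of the `β' = 0` SZZ dynamics are known on the ridge functions
`y ↦ U_n(⟨ρ g, ρ y_e⟩)` (`integral_prod_gegenbauer_latitude`); to make this a determining class one needs that
continuous functions on `[-1, 1]` are uniformly approximated by finite linear combinations `Σ_{k<N} c_k U_k`.  Here: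

* `gegenbauerSum_one_succ_succ` — the Chebyshev recurrence `U_{n+2} = 2 s U_{n+1} - U_n` for `gegenbauerSum 1`;
* `exists_sum_gegenbauerSum_eq_polynomial` — every real polynomial is `Σ_{k<N} c_k U_k` as a function on `ℝ`;
* `exists_sum_gegenbauerSum_near` — **Weierstrass in the `U`-basis**: for `f` continuous on `[-1, 1]` and `ε > 0` there
  are `N`, `c` with `|f(s) - Σ_{k<N} c_k U_k(s)| ≤ ε` on `[-1, 1]` (Mathlib's `exists_polynomial_near_of_continuousOn`).

No definition, no sorry.  RECORD-rung R3 plumbing; nothing here bears on the mass gap.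
-/

set_option autoImplicit false

noncomputable section

namespace Summit.QuantumFields.YangMills.Theorems.ColdStartUniversality

open Finset
open scoped BigOperators
open Literature.Analysis.SpecialFunctions (gegenbauerSum gegenbauerSum_rec gegenbauerSum_one gegenbauerSum_zero)

/-- **Chebyshev recurrence** for `U_n = C_n^{(1)}`: `U_{n+2}(s) = 2 s U_{n+1}(s) - U_n(s)`. [folklore] -/
theorem gegenbauerSum_one_succ_succ (n : ℕ) (s : ℝ) :
    gegenbauerSum 1 (n + 2) s = 2 * s * gegenbauerSum 1 (n + 1) s - gegenbauerSum 1 n s := by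
  have hrec := gegenbauerSum_rec 1 n s
  have hne : ((n : ℝ) + 2) ≠ 0 := by positivity
  have : ((n : ℝ) + 2) * gegenbauerSum 1 (n + 2) s =
      ((n : ℝ) + 2) * (2 * s * gegenbauerSum 1 (n + 1) s - gegenbauerSum 1 n s) := by
    rw [hrec]; ring
  exact mul_left_cancel₀ hne this

/-- `s · U_n(s)` in the `U`-basis: `s U_0 = U_1 / 2` and `s U_{n+1} = (U_{n+2} + U_n) / 2`. [folklore] -/
theorem mul_gegenbauerSum_one_succ (n : ℕ) (s : ℝ) :
    s * gegenbauerSum 1 (n + 1) s = (gegenbauerSum 1 (n + 2) s + gegenbauerSum 1 n s) / 2 := by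
  rw [gegenbauerSum_one_succ_succ]; ring

/-- `s · U_0(s) = U_1(s) / 2`. [folklore] -/
theorem mul_gegenbauerSum_one_zero (s : ℝ) : s * gegenbauerSum 1 0 s = gegenbauerSum 1 1 s / 2 := by
  rw [gegenbauerSum_zero, gegenbauerSum_one]; ring

/-- The `U`-span is closed under addition. [folklore] -/
theorem exists_sum_gegenbauerSum_add {f g : ℝ → ℝ}
    (hf : ∃ (N : ℕ) (c : ℕ → ℝ), ∀ s : ℝ, f s = ∑ k ∈ range N, c k * gegenbauerSum 1 k s)
    (hg : ∃ (N : ℕ) (c : ℕ → ℝ), ∀ s : ℝ, g s = ∑ k ∈ range N, c k * gegenbauerSum 1 k s) :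
    ∃ (N : ℕ) (c : ℕ → ℝ), ∀ s : ℝ, f s + g s = ∑ k ∈ range N, c k * gegenbauerSum 1 k s := by
  classical
  obtain ⟨N, c, hc⟩ := hf
  obtain ⟨M, d, hd⟩ := hg
  refine ⟨max N M, fun k => (if k < N then c k else 0) + (if k < M then d k else 0), fun s => ?_⟩
  rw [hc, hd]
  simp only [add_mul, Finset.sum_add_distrib]
  congr 1
  · rw [← Finset.sum_subset (Finset.range_subset_range.2 (le_max_left N M))]
    · exact Finset.sum_congr rfl fun k hk => by rw [if_pos (Finset.mem_range.1 hk)]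
    · intro k _ hk
      rw [if_neg (fun h => hk (Finset.mem_range.2 h)), zero_mul]
  · rw [← Finset.sum_subset (Finset.range_subset_range.2 (le_max_right N M))]
    · exact Finset.sum_congr rfl fun k hk => by rw [if_pos (Finset.mem_range.1 hk)]
    · intro k _ hk
      rw [if_neg (fun h => hk (Finset.mem_range.2 h)), zero_mul]

/-- The `U`-span is closed under scalars. [folklore] -/
theorem exists_sum_gegenbauerSum_smul {f : ℝ → ℝ} (a : ℝ)
    (hf : ∃ (N : ℕ) (c : ℕ → ℝ), ∀ s : ℝ, f s = ∑ k ∈ range N, c k * gegenbauerSum 1 k s) :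
    ∃ (N : ℕ) (c : ℕ → ℝ), ∀ s : ℝ, a * f s = ∑ k ∈ range N, c k * gegenbauerSum 1 k s := by
  obtain ⟨N, c, hc⟩ := hf
  refine ⟨N, fun k => a * c k, fun s => ?_⟩
  rw [hc, Finset.mul_sum]
  exact Finset.sum_congr rfl fun k _ => by ring

/-- The `U`-span is closed under finite sums. [folklore] -/
theorem exists_sum_gegenbauerSum_finsetSum {ι : Type} (t : Finset ι) {F : ι → ℝ → ℝ}
    (hF : ∀ i ∈ t, ∃ (N : ℕ) (c : ℕ → ℝ), ∀ s : ℝ, F i s = ∑ k ∈ range N, c k * gegenbauerSum 1 k s) :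
    ∃ (N : ℕ) (c : ℕ → ℝ), ∀ s : ℝ, ∑ i ∈ t, F i s = ∑ k ∈ range N, c k * gegenbauerSum 1 k s := by
  classical
  induction t using Finset.induction_on with
  | empty => exact ⟨0, fun _ => 0, fun s => by simp⟩
  | insert a t ha ih =>
    have h1 := hF a (Finset.mem_insert_self a t)
    have h2 := ih fun i hi => hF i (Finset.mem_insert_of_mem hi)
    obtain ⟨N, c, hc⟩ := exists_sum_gegenbauerSum_add h1 h2
    exact ⟨N, c, fun s => by rw [Finset.sum_insert ha]; exact hc s⟩

/-- `U_k` is in the `U`-span. [folklore] -/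
theorem exists_sum_gegenbauerSum_self (k : ℕ) :
    ∃ (N : ℕ) (c : ℕ → ℝ), ∀ s : ℝ, gegenbauerSum 1 k s = ∑ j ∈ range N, c j * gegenbauerSum 1 j s := by
  classical
  refine ⟨k + 1, fun j => if j = k then 1 else 0, fun s => ?_⟩
  rw [Finset.sum_eq_single k]
  · simp
  · intro j _ hj; simp [hj]
  · intro h; exact absurd (Finset.mem_range.2 (Nat.lt_succ_self k)) h

/-- `s · U_k(s)` is in the `U`-span. [folklore] -/
theorem exists_sum_gegenbauerSum_mul_self (k : ℕ) :
    ∃ (N : ℕ) (c : ℕ → ℝ), ∀ s : ℝ, s * gegenbauerSum 1 k s = ∑ j ∈ range N, c j * gegenbauerSum 1 j s := by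
  rcases k with _ | k
  · obtain ⟨N, c, hc⟩ := exists_sum_gegenbauerSum_smul (1 / 2) (exists_sum_gegenbauerSum_self 1)
    exact ⟨N, c, fun s => by rw [mul_gegenbauerSum_one_zero, ← hc s]; ring⟩
  · obtain ⟨N, c, hc⟩ := exists_sum_gegenbauerSum_smul (1 / 2)
      (exists_sum_gegenbauerSum_add (exists_sum_gegenbauerSum_self (k + 2)) (exists_sum_gegenbauerSum_self k))
    exact ⟨N, c, fun s => by rw [mul_gegenbauerSum_one_succ, ← hc s]; ring⟩

/-- Multiplication by `s` preserves the `U`-span. [folklore] -/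
theorem exists_sum_gegenbauerSum_mul {f : ℝ → ℝ}
    (hf : ∃ (N : ℕ) (c : ℕ → ℝ), ∀ s : ℝ, f s = ∑ k ∈ range N, c k * gegenbauerSum 1 k s) :
    ∃ (N : ℕ) (c : ℕ → ℝ), ∀ s : ℝ, s * f s = ∑ k ∈ range N, c k * gegenbauerSum 1 k s := by
  obtain ⟨N, c, hc⟩ := hf
  have h := exists_sum_gegenbauerSum_finsetSum (range N) (F := fun k s => c k * (s * gegenbauerSum 1 k s))
    (fun k _ => exists_sum_gegenbauerSum_smul (c k) (exists_sum_gegenbauerSum_mul_self k))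
  obtain ⟨M, d, hd⟩ := h
  refine ⟨M, d, fun s => ?_⟩
  rw [hc, Finset.mul_sum, ← hd s]
  exact Finset.sum_congr rfl fun k _ => by ring

/-- **Every real polynomial is a finite `U`-combination**: `p(s) = Σ_{k<N} c_k U_k(s)` on `ℝ`. [folklore] -/
theorem exists_sum_gegenbauerSum_eq_polynomial (p : Polynomial ℝ) :
    ∃ (N : ℕ) (c : ℕ → ℝ), ∀ s : ℝ, p.eval s = ∑ k ∈ range N, c k * gegenbauerSum 1 k s := by
  classical
  induction p using Polynomial.induction_on' with
  | add p q hp hq =>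
    obtain ⟨N, c, hc⟩ := exists_sum_gegenbauerSum_add hp hq
    exact ⟨N, c, fun s => by rw [Polynomial.eval_add]; exact hc s⟩
  | monomial n a =>
    induction n with
    | zero =>
      refine ⟨1, fun _ => a, fun s => ?_⟩
      simp [gegenbauerSum_zero]
    | succ n ih =>
      obtain ⟨N, c, hc⟩ := exists_sum_gegenbauerSum_mul ih
      refine ⟨N, c, fun s => ?_⟩
      have h := hc s
      rw [Polynomial.eval_monomial] at h ⊢
      rw [pow_succ, ← mul_assoc, mul_comm (a * s ^ n) s, h]

/-- **Weierstrass approximation in the Chebyshev basis**: a function continuous on `[-1, 1]` is uniformly approximated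
there by finite combinations `Σ_{k<N} c_k U_k`. [folklore] -/
theorem exists_sum_gegenbauerSum_near {f : ℝ → ℝ} (hf : ContinuousOn f (Set.Icc (-1) 1)) {ε : ℝ} (hε : 0 < ε) :
    ∃ (N : ℕ) (c : ℕ → ℝ), ∀ s ∈ Set.Icc (-1 : ℝ) 1, |f s - ∑ k ∈ range N, c k * gegenbauerSum 1 k s| ≤ ε := by
  obtain ⟨p, hp⟩ := exists_polynomial_near_of_continuousOn (-1) 1 f hf ε hε
  obtain ⟨N, c, hc⟩ := exists_sum_gegenbauerSum_eq_polynomial p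
  refine ⟨N, c, fun s hs => ?_⟩
  rw [← hc s, abs_sub_comm]
  exact (hp s hs).le

end Summit.QuantumFields.YangMills.Theorems.ColdStartUniversality

end
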